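import Literature.NumberTheory.Automorphic.UnitaryGroupSymplecticEmbedding
import Literature.NumberTheory.Automorphic.UnitaryGroupSplitPlace
import Mathlib.NumberTheory.NumberField.CMField
import Mathlib.LinearAlgebra.Matrix.PosDef
import HarnessLib

/-!
# Crux `H413`, E-2 Siegel–Weil child line — a hermitian form over a quadratic CM extension `E/F` which is DEFINITE at one complex
# embedding is ANISOTROPIC (the abstract-involution form of ★ `anisotropic_of_posDef_map`, in the `(F, E, c, δ)` currency of the dual pairs)

Cell hodgecm-mathlib (D-0151), FLOOR 0, crux item H413 = stmt-HodgeConjecture-24833, programme P4, engine E-2, the I-CLOSE assembly of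
the Siegel–Weil child line `Cruxes/H413/Lines/F0_E2SiegelWeilWeilRange.lean` (sheet `SW2-ICLOSE-ASSEMBLY.v0` §1 (Θ-DEC): «`μ̂_0 = 0` —
ANISOTROPY: `U(0)_F = ∅` since `J_V` is definite at an archimedean place»; F0P4-plan (g4) row 2026-08-31T03:11:49Z (1)).  Namespace
`Summit.HodgeConjecture.HodgeConjecture.Cruxes.H413.E2SWHermFormAnisotropic`.  Helper file (`--supports stmt-HodgeConjecture-24833 --as helper`);
THEOREMS ONLY (no `def`, no instance, no notation, no `sorry`, no named fact); imports Literature + Mathlib only (no `Cruxes/…/Lines`, nothing on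
the R2 reverse cone).  Author A-p18 (g17).

The tree already proves the statement for a CM field `L` with ITS complex conjugation ★ `UnitaryGroup.anisotropic_of_posDef_map`
(`AdelicUnitaryGroupDatum`): `(H.map τ).PosDef → ∀ x, hermForm (cmConjRingHom L) H x x = 0 → x = 0`.  The E-2 letters (★
`Li1992.KernelRallisIdentityUnitaryRankOneCM`, ED. 3) speak instead of an ABSTRACT quadratic extension `E/F` with a non-trivial
`F`-automorphism `c : E ≃ₐ[F] E` (`c δ = −δ`, `δ ≠ 0`), `F` totally real, `E` totally complex, and a complex embedding `τ : E →+* ℂ` with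
`(J_V.map τ).PosDef`.  This file supplies the same anisotropy in that currency, for the tree's pairing ★ `UnitaryGroup.hermForm σ H x y =
(σ ∘ x) ⬝ᵥ (H *ᵥ y)`:
* §1 `hermForm_self_eq_zero_imp_of_posDef_map` — ANY commutative ring `S` with an involution `σ` INTERTWINED by an injective `τ : S →+* ℂ`
  (`τ (σ x) = conj (τ x)`): `(H.map τ).PosDef → hermForm σ H x x = 0 → x = 0` (apply `τ`: `τ⟪x,x⟫ = (τx)ᴴ (τH) (τx) > 0` for `x ≠ 0`).
* §2 `apply_algEquiv_eq_conj` — for `E/F` quadratic, `F` totally real, `E` totally complex, EVERY non-trivial `F`-automorphism `c` IS complex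
  conjugation under every embedding: `φ (c x) = conj (φ x)` (Mathlib `IsCMField.ofCMExtension`, `IsCMField.complexEmbedding_complexConj`,
  and `Gal(E/F) = {1, c}` ★ `algEquiv_eq_one_or_eq`); `algEquiv_ne_one_of_apply_eq_neg` (`c δ = −δ`, `δ ≠ 0 ⇒ c ≠ 1`).
* §3 **`hermForm_self_eq_zero_imp_of_posDef_map_quadratic`** — the E-2 form: `(J.map τ).PosDef → hermForm (c : E →+* E) J x x = 0 → x = 0`.
* §4 the RANK-ONE KRONECKER factor of the dual pair (`J_V ⊗ₖ J_W`, `J_W` a `1 × 1` matrix): `hermForm σ (J ⊗ₖ J₁) z w =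
  J₁ 0 0 * hermForm σ J (z (·,0)) (w (·,0))` (`hermForm_kronecker_one`) and anisotropy of `J ⊗ₖ J₁` from that of `J` when `J₁ 0 0 ≠ 0`
  (`hermForm_kronecker_one_self_eq_zero_imp`) — no sign condition on `J_W` is needed.
Consumer: the sequel `Theorems/H413E2SWHNormAnisotropic.lean` (`hNorm (ratPt ξ) = 0 ↔ ξ = 0` over ★ `Weil1965.UnitaryDoubling.hNorm` once
its rational value is exposed by FILE 2e of the I-STRUCT-I chain).

HC_CM is proved only modulo the 7 printed citations until rung 0 closes; this file is linear algebra and proves nothing printed.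

## References
* [Weil1965] A. Weil, *Sur la formule de Siegel dans la théorie des groupes classiques*, Acta Math. 113 (1965), n° 52 (the rank-0 term of the
  theta integral; `U(0)_k = ∅` for an anisotropic form).
* [BergeronMillsonMoeglin2016Balls] N. Bergeron, J. Millson, C. Mœglin, *Hodge type theorems for arithmetic manifolds associated to
  orthogonal groups* / the ball-quotient companion, Part 2 §1.1 (the completions `V_τ`, definiteness at one place).
-/

set_option autoImplicit false
-- the mandated namespace has the single-problem summit's repeated segment (`HodgeConjecture.HodgeConjecture`)
set_option linter.dupNamespace false

open scoped Matrix Kronecker ComplexOrder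
open NumberField
open Literature.NumberTheory.Automorphic Literature.NumberTheory.Automorphic.UnitaryGroup

namespace Summit.HodgeConjecture.HodgeConjecture.Cruxes.H413.E2SWHermFormAnisotropic

/-! ## §1 Anisotropy from definiteness at one embedding — any involution intertwined by the embedding -/

section Generic

variable {S : Type*} [CommRing S] {n : Type*} [Fintype n]

/-- **Transport of the hermitian pairing along an intertwining embedding**: if `τ (σ x) = conj (τ x)` then
`τ ⟪x, y⟫_{σ,H} = (τ x)ᴴ · (H.map τ) · (τ y)` (Mathlib's `star u ⬝ᵥ (M *ᵥ v)`). [folklore] -/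
theorem map_hermForm_eq_star_dotProduct (σ : S →+* S) (τ : S →+* ℂ) (hστ : ∀ x, τ (σ x) = starRingEnd ℂ (τ x))
    (H : Matrix n n S) (x y : n → S) :
    τ (hermForm σ H x y) = star (⇑τ ∘ x) ⬝ᵥ (H.map τ *ᵥ (⇑τ ∘ y)) := by
  simp only [hermForm, dotProduct, Matrix.mulVec, Function.comp_apply, map_sum, map_mul, hστ, Matrix.map_apply,
    Pi.star_apply, Complex.star_def]

/-- **A form which is positive definite at ONE intertwining complex embedding is anisotropic**: for an injective
`τ : S →+* ℂ` with `τ ∘ σ = conj ∘ τ` and `(H.map τ)` positive definite, `⟪x, x⟫_{σ,H} = 0 ⇒ x = 0`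
(apply `τ`: `(τx)ᴴ (τH) (τx) > 0` unless `τ x = 0`). [folklore] -/
theorem hermForm_self_eq_zero_imp_of_posDef_map (σ : S →+* S) (τ : S →+* ℂ) (hστ : ∀ x, τ (σ x) = starRingEnd ℂ (τ x))
    (hτ : Function.Injective τ) (H : Matrix n n S) (hH : (H.map τ).PosDef) (x : n → S) (hx : hermForm σ H x x = 0) : x = 0 := by
  by_contra hne
  have hτx : (⇑τ ∘ x) ≠ 0 := by
    intro h0
    apply hne
    funext i
    exact hτ (by simpa using congrFun h0 i)
  have hpos := hH.dotProduct_mulVec_pos hτx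
  rw [← map_hermForm_eq_star_dotProduct σ τ hστ H x x, hx, map_zero] at hpos
  exact lt_irrefl _ hpos

end Generic

/-! ## §2 Quadratic CM extensions: every non-trivial `F`-automorphism is complex conjugation under every embedding -/

section Quadratic

variable (F : Type*) {E : Type*} [Field F] [NumberField F] [Field E] [NumberField E] [Algebra F E]

omit [NumberField F] in
/-- `c δ = −δ` with `δ ≠ 0` forces `c ≠ 1` (characteristic `0`). [folklore] -/
theorem algEquiv_ne_one_of_apply_eq_neg (c : E ≃ₐ[F] E) {δ : E} (hcδ : c δ = -δ) (hδ : δ ≠ 0) : c ≠ 1 := by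
  intro h
  rw [h, AlgEquiv.one_apply] at hcδ
  exact hδ (add_self_eq_zero.1 (eq_neg_iff_add_eq_zero.1 hcδ))

variable [Algebra.IsQuadraticExtension F E] [IsTotallyReal F] [IsTotallyComplex E]

/-- **In a quadratic extension `E/F` of a totally real field by a totally complex one, a non-trivial `F`-automorphism `c` IS
complex conjugation under every complex embedding**: `φ (c x) = conj (φ x)`.  (`E` is CM with `E⁺ ⊇ F` of index `1`; Mathlib's
`IsCMField.complexConj E` is an `F`-automorphism `≠ 1`, and `Gal(E/F) = {1, c}`.) [folklore] -/
theorem apply_algEquiv_eq_conj (c : E ≃ₐ[F] E) (hc : c ≠ 1) (φ : E →+* ℂ) (x : E) :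
    φ (c x) = starRingEnd ℂ (φ x) := by
  letI : IsCMField E := IsCMField.ofCMExtension F E
  have hcomm : ∀ a : F, IsCMField.complexConj E (algebraMap F E a) = algebraMap F E a := fun a => by
    have h : ((CMExtension.equivMaximalRealSubfield F E a : maximalRealSubfield E) : E) = algebraMap F E a :=
      CMExtension.equivMaximalRealSubfield_apply F E a
    rw [← h]
    exact IsCMField.complexConj_apply_eq_self (K := E) _
  let cc : E ≃ₐ[F] E := { (IsCMField.complexConj E).toRingEquiv with commutes' := hcomm }
  have hccx : ∀ y : E, cc y = IsCMField.complexConj E y := fun _ => rfl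
  have hcc1 : cc ≠ 1 := by
    intro h
    apply IsCMField.complexConj_ne_one (K := E)
    ext y
    have hy := congrArg (fun f : E ≃ₐ[F] E => f y) h
    simp only [AlgEquiv.one_apply] at hy
    rw [hccx] at hy
    simpa using hy
  have hcc : cc = c := (algEquiv_eq_one_or_eq F hc cc).resolve_left hcc1
  rw [← hcc, hccx]
  exact IsCMField.complexEmbedding_complexConj E φ x

/-- The same for the automorphism read as a ring homomorphism (the `σ` of ★ `hermForm`). [folklore] -/
theorem ringHom_algEquiv_eq_conj (c : E ≃ₐ[F] E) (hc : c ≠ 1) (φ : E →+* ℂ) (x : E) :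
    φ ((c : E →+* E) x) = starRingEnd ℂ (φ x) :=
  apply_algEquiv_eq_conj F c hc φ x

/-! ## §3 The E-2 currency: `(J.map τ).PosDef ⇒ J` anisotropic for `hermForm c` -/

/-- **ANISOTROPY OF A HERMITIAN FORM OVER A QUADRATIC CM EXTENSION DEFINITE AT ONE EMBEDDING** — the currency of the E-2 letters
(★ `Li1992.KernelRallisIdentityUnitaryRankOneCM`: `c δ = −δ`, `δ ≠ 0`, `F` totally real, `E` totally complex, `(J_V.map τ).PosDef`):
`hermForm c J x x = 0 ⇒ x = 0`.  In particular `U(0)_F = ∅` for the rational points of norm `0` (Weil's rank-0 term). [folklore] -/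
theorem hermForm_self_eq_zero_imp_of_posDef_map_quadratic {n : Type*} [Fintype n] (c : E ≃ₐ[F] E) {δ : E} (hcδ : c δ = -δ)
    (hδ : δ ≠ 0) (τ : E →+* ℂ) (J : Matrix n n E) (hτ : (J.map τ).PosDef) (x : n → E)
    (hx : hermForm (c : E →+* E) J x x = 0) : x = 0 :=
  hermForm_self_eq_zero_imp_of_posDef_map (c : E →+* E) τ
    (ringHom_algEquiv_eq_conj F c (algEquiv_ne_one_of_apply_eq_neg F c hcδ hδ) τ) τ.injective J hτ x hx

end Quadratic

/-! ## §4 The rank-one Kronecker factor of a dual pair `(U(J_V), U(J_W))`, `J_W` a `1 × 1` matrix -/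

section KroneckerOne

variable {S : Type*} [CommRing S] {n : Type*} [Fintype n]

/-- **`⟪z, w⟫_{J ⊗ J₁} = J₁₀₀ · ⟪z(·,0), w(·,0)⟫_J`** for a `1 × 1` second factor (the dual-pair form `J_V ⊗ₖ J_W` with `dim W = 1`).
[folklore] -/
theorem hermForm_kronecker_one (σ : S →+* S) (J : Matrix n n S) (J₁ : Matrix (Fin 1) (Fin 1) S) (z w : n × Fin 1 → S) :
    hermForm σ (J ⊗ₖ J₁) z w = J₁ 0 0 * hermForm σ J (fun i => z (i, 0)) (fun i => w (i, 0)) := by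
  simp only [hermForm, dotProduct, Matrix.mulVec, Function.comp_apply, Fintype.sum_prod_type, Finset.univ_unique,
    Fin.default_eq_zero, Finset.sum_singleton, Matrix.kroneckerMap_apply, Finset.mul_sum]
  refine Finset.sum_congr rfl fun i _ => Finset.sum_congr rfl fun j _ => ?_
  ring

/-- **Anisotropy passes to `J ⊗ₖ J₁` when `J₁₀₀ ≠ 0`** (a domain `S`): `⟪z, z⟫_{J ⊗ J₁} = 0 ⇒ z = 0`.  No sign condition on `J₁`.
[folklore] -/
theorem hermForm_kronecker_one_self_eq_zero_imp [IsDomain S] (σ : S →+* S) (J : Matrix n n S) (J₁ : Matrix (Fin 1) (Fin 1) S)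
    (hJ₁ : J₁ 0 0 ≠ 0) (hJ : ∀ x : n → S, hermForm σ J x x = 0 → x = 0) (z : n × Fin 1 → S)
    (hz : hermForm σ (J ⊗ₖ J₁) z z = 0) : z = 0 := by
  rw [hermForm_kronecker_one] at hz
  have h0 := hJ _ ((mul_eq_zero.1 hz).resolve_left hJ₁)
  funext p
  obtain ⟨i, k⟩ := p
  have hk : k = 0 := Subsingleton.elim _ _
  subst hk
  exact congrFun h0 i

/-- **The dual-pair form `J_V ⊗ₖ J_W` (`dim W = 1`, `J_W` invertible) over a quadratic CM extension with `J_V` definite at one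
embedding is anisotropic** — the shape the Siegel–Weil I-CLOSE assembly consumes for `μ̂_0 = 0`. [folklore] -/
theorem hermForm_kronecker_one_self_eq_zero_imp_of_posDef_map_quadratic
    {F E : Type*} [Field F] [NumberField F] [Field E] [NumberField E] [Algebra F E]
    [Algebra.IsQuadraticExtension F E] [IsTotallyReal F] [IsTotallyComplex E]
    {m : Type*} [Fintype m] (c : E ≃ₐ[F] E) {δ : E} (hcδ : c δ = -δ) (hδ : δ ≠ 0) (τ : E →+* ℂ)
    (JV : Matrix m m E) (hτ : (JV.map τ).PosDef) (JW : Matrix (Fin 1) (Fin 1) E) (hJW : JW 0 0 ≠ 0)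
    (z : m × Fin 1 → E) (hz : hermForm (c : E →+* E) (JV ⊗ₖ JW) z z = 0) : z = 0 :=
  hermForm_kronecker_one_self_eq_zero_imp (c : E →+* E) JV JW hJW
    (fun x hx => hermForm_self_eq_zero_imp_of_posDef_map_quadratic F c hcδ hδ τ JV hτ x hx) z hz

end KroneckerOne

end Summit.HodgeConjecture.HodgeConjecture.Cruxes.H413.E2SWHermFormAnisotropic
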